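import Summits.BirchSwinnertonDyer.Rank1Residual.Partition.Rows
import Literature.NumberTheory.EllipticCurves.Rank1Residual.Typed.KimCertificate
import Literature.NumberTheory.EllipticCurves.Rank1Residual.Typed.CasselsLowerBound
import Literature.NumberTheory.EllipticCurves.NonEisensteinPrimeOfSurjective
import HarnessLib

/-!
# Rank ONE, `ord_p ∏ c_ℓ = 1`: a level-two Kurihara certificate + Cassels–Tate parity ⇒ `BSD(E,p)` (classes X4 and X11b; cell `b2b-bsdres`, seat harvest-2 GEN 6)

HONEST FRAMING (cell `b2b-bsdres`, run/shared/lean/b2b/bsd-rank1-residual/, verbatim in every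
file): the goal of the cell is to DELETE the COMBINATION-SHAPED residual classes of the
Birch–Swinnerton-Dyer formula for ALL analytic-rank `≤ 1` elliptic curves over `ℚ` — "full BSD
formula for every rank `≤ 1` curve in class `C`" assembled STRICTLY from published theorems — so
that the rank-`≤ 1` remainder becomes exactly the CONSTRUCTION-SHAPED classes, which are TYPED
(missing-input `Prop`s), NOT attempted. This is not "finishing BSD". Prove what is provable now;
shrink each hard class to its core with data; no claim beyond stated classes.

**What this file proves** (theorems only; no definition, no new named fact). Companion of
`Additive/X4RankZeroTamagawaParity.lean` (rank `0`). In analytic rank `1` the unit-Kurihara-number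
lever (Kim 2026 Thm. 1.8 (6): one `δ̃_ℓ ≢ 0 (mod p)` ⇒ `Ш[p^∞] = 0`; tree facts
`Kim2022_rankOne_card_sha_eq_one_of_kuriharaNumber_ne_zero[_of_maninConstant]`) cannot fire when
`p ∣ ∏ c_ℓ(E)` (Kim's Conjecture 1.10: `∂^{(∞)}(δ̃) = ∑ ord_p c_ℓ`; the cell's engines see exactly
this — HARVEST §GEN-6 E26: 18/18 zeros on the control pairs). One level up the certificate exists:
the named fact `Kim2022_rankOne_padicValNat_sha_le_one_of_kuriharaNumber_levelTwo_ne_zero_of_maninConstant`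
(C.-H. Kim, Amer. J. Math. 148 (2026) Thm. 1.8 (6) read as an INEQUALITY: one Kurihara number
`δ̃_ℓ ≢ 0 (mod p²)` at a Kolyvagin prime `ℓ ∈ 𝒫_2` — `ℓ ≡ 1`, `a_ℓ ≡ ℓ + 1 (mod p²)` — gives
`ord(δ̃) = 1`, `∂^{(1)}(δ̃) ≤ 1`, hence `length Ш(E/ℚ)[p^∞] ≤ 1`; ANY reduction at `p`) bounds
`ord_p #Ш ≤ 1`, and Cassels' theorem (`#Ш` is a perfect square: bsd.S18
`exists_casselsTate_pairing`, `isSquare_shaOrder_of_casselsTate`) makes `ord_p #Ш` even — so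
`Ш(E/ℚ)[p^∞] = 0`, and with the lane's `#Ш_an = q` a `p`-unit this is Miller's `BSD(E,p)`
(`Typed.bsdp_of_shaAn_unit_of_noPTorsion`).
* `padicValNat_shaOrder_eq_zero_of_kim_rankOne_levelTwo_of_casselsTate` (class-agnostic) and
  `bsdp_of_kim_rankOne_levelTwo_of_casselsTate` (⇒ `BSDp W p`);
* `X4RankOne.bsdp_of_casselsTate_of_kuriharaNumber_levelTwo` — over the cell's `ClassX4 W p`;
* `X11b.bsdp_of_casselsTate_of_kuriharaNumber_levelTwo` — over the v5 `ClassX11b W p`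
  (`Partition/Rows.lean`), with the datum `D` (at `p ∥ N` its Manin hypothesis is Mazur's theorem /
  ARS Thm. 2.6, discharged per curve by `AgasheRibetStein2006.not_dvd_maninConstant_of_level_le` for
  the optimal curve, `N ≤ 130000`).

**Where it bites (census `N < 2·10⁴`; hyp seat `hyp_bits.tsv`).** Rank-`1`, `p ≥ 5`, `ρ̄` onto,
`ord_p ∏ c_ℓ = 1`, `#Ш_an` a `p`-unit: X4 — 14850cc1@5, 18326j1@7; X11b ∧ sst — 14835f1@5,
16390q1@5, 19090e1@5 (+ 1 non-semistable X11b pair already closed by the x11c seat). First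
certificate (this seat's engine B at `𝒫_2` primes, HARVEST §GEN-6 E27): 14835f1@5, `ℓ = 1801`,
`δ̃_ℓ ≡ 5 (mod 25)` — non-zero of valuation exactly `1`, as Conjecture 1.10 predicts; farm jobs
j078994 (engine B) / j078995 (PARI `msfromell` via cypari2) for all five. Table-wide the shape
(`r = 1`, `ord_p ∏c_ℓ = 1`, `p ∤ #Ш_an`, surj, `p ≥ 5`) has 480 ‖ 185 X4 classes and 2208 ‖ 986
X11b classes below `2·10⁴ ‖ 10⁴` (most already closed per pair by Heegner-index certificates; the
five above are the v5 residue). Per pair; NOT a class theorem; no label changes.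

References: Kim 2026 [Kim2022StructureSelmer] Thm. 1.9 (6), §1.2.2, §1.5.1, Conj. 1.10; Cassels
1962 / Silverman AEC X.4.14 [SilvermanAEC2009]; Miller 2011 [Miller2011LMS] Def. 1.1; Mazur 1978
[Mazur1978]; cell files `b2b-bsdres-harvest-2/HARVEST.md` §GEN-6 E26–E27, RECLASSIFY item 31/36.
-/

noncomputable section

open scoped Classical MatrixGroups ModularForm

open CongruenceSubgroup WeierstrassCurve Literature.NumberTheory.EllipticCurves
  Literature.NumberTheory.EllipticCurves.ModularForms
  Literature.NumberTheory.EllipticCurves.Rank1Residual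
  Literature.NumberTheory.EllipticCurves.Rank1Residual.Typed

namespace Summit.BirchSwinnertonDyer.Rank1Residual

variable (W : WeierstrassCurve ℚ) [W.IsElliptic] [W.IsGloballyMinimal] (p : ℕ) [Fact p.Prime]

/-! ### Class-agnostic (ANY reduction type at `p`) -/

/-- **Rank `1`, `p ≥ 5`, `ρ̄_{E,p}` onto, `p ∤ c_D`, period transfer, ONE Kurihara number
`δ̃_ℓ ≢ 0 (mod p²)` at a level-two Kolyvagin prime: `ord_p #Ш(E/ℚ) = 0`.** Kim's clause (6) read
as an inequality (`hKim2`: `ord_p #Ш(p) ≤ 1`) and Cassels' theorem (`hCT`: `#Ш` is a square, `Ш`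
finite by Gross–Zagier–Kolyvagin `hGZK`) — an even number `≤ 1` is `0`. Modularity `hmod` reads
`r_an = 1` as `L(E,1) = 0`. ANY reduction at `p`. [cite: Kim2022StructureSelmer, Thm. 1.9 (6) (PDF p. 8), §1.2.2, §1.5.1]
[cite: SilvermanAEC2009, Thm. X.4.14] -/
theorem padicValNat_shaOrder_eq_zero_of_kim_rankOne_levelTwo_of_casselsTate
    (hKim2 : Kim2022_rankOne_padicValNat_sha_le_one_of_kuriharaNumber_levelTwo_ne_zero_of_maninConstant)
    (hCT : exists_casselsTate_pairing (K := ℚ))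
    (hGZK : rank_eq_analyticRank_of_analyticRank_le_one) (hmod : hasEntireLFunction_rat)
    (hp : 5 ≤ p) (hsurj : W.HasSurjectiveModNGaloisRep p) (hr : W.analyticRank = 1)
    {N : ℕ} [NeZero N] (D : ModularParametrizationData W N) (hc : ¬ (p : ℤ) ∣ D.maninConstant)
    (hper : ∃ u : ℚ, ‖(u : ℚ_[p])‖ = 1 ∧ W.realPeriodRat = u * plusPeriod D.f)
    (ℓ : ℕ) [Fact ℓ.Prime] (hℓ : Kato.IsKolyvaginPrime W p 2 ℓ)
    (hcyc : Nat.card {P : ((WeierstrassCurve.integralModelInt W).map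
        (Int.castRingHom (ZMod ℓ))).toAffine.Point // p • P = 0} ≤ p)
    (ψ : (ℓ' : ℕ) → (ZMod ℓ')ˣ →* Multiplicative (ZMod (p ^ 2)))
    (hψ : Function.Surjective (ψ ℓ)) (hδ : kuriharaNumber D.f (p ^ 2) ℓ ψ ≠ 0) :
    padicValNat p W.shaOrder = 0 := by
  have hr1 : W.analyticRank ≤ 1 := by rw [hr]
  have hL : W.entireLFunction 1 = 0 := by
    by_contra hne
    have h0 := (W.analyticRank_eq_zero_iff_holds (hmod W)).mpr hne
    omega
  have hfin : W.ShaFinite := (hGZK W hr1).2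
  haveI : Finite W.sha := hfin
  have hle : padicValNat p (Nat.card (AddCommGroup.primaryComponent W.sha p)) ≤ 1 :=
    hKim2 W p hp hsurj hL hr hfin D hc hper ℓ hℓ hcyc ψ hψ hδ
  rw [padicValNat_card_addPrimaryComponent p] at hle
  have hsq : IsSquare W.shaOrder := isSquare_shaOrder_of_casselsTate hCT W hfin
  have hn : W.shaOrder ≠ 0 := (WeierstrassCurve.shaOrder_pos W hfin).ne'
  by_contra h
  have hdvd : p ∣ W.shaOrder := by
    by_contra hnd
    exact h (padicValNat.eq_zero_of_not_dvd hnd)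
  have h2 : 2 ≤ padicValNat p W.shaOrder := two_le_padicValNat_of_isSquare_of_dvd hsq hn hdvd
  have : padicValNat p W.shaOrder ≤ 1 := by
    unfold WeierstrassCurve.shaOrder; exact hle
  omega

/-- **`BSD(E,p)` in analytic rank `1` from ONE non-zero Kurihara number MODULO `p²` at a level-two
Kolyvagin prime, `#Ш_an` a `p`-unit — class-agnostic, ANY reduction at `p`.** Kim 2026 Thm. 1.8 (6)
as the inequality `ord_p #Ш ≤ 1` (`hKim2`) + Cassels–Tate squareness (`hCT`) ⇒ `Ш(E/ℚ)[p] = 0`;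
then `Typed.bsdp_of_shaAn_unit_of_noPTorsion` (Gross–Zagier–Kolyvagin `hGZK`, the lane's exact
`#Ш_an = q` with `ord_p q = 0`). The rank-`1` companion of the rank-`0` parity closure; aimed at the
pairs with `ord_p ∏ c_ℓ = 1`, where no UNIT Kurihara number exists. Per pair; NOT a class theorem.
[cite: Kim2022StructureSelmer, Thm. 1.9 (6) (PDF p. 8), Conj. 1.10] [cite: SilvermanAEC2009, Thm. X.4.14]
[cite: Miller2011LMS, Def. 1.1] -/
theorem bsdp_of_kim_rankOne_levelTwo_of_casselsTate
    (hKim2 : Kim2022_rankOne_padicValNat_sha_le_one_of_kuriharaNumber_levelTwo_ne_zero_of_maninConstant)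
    (hCT : exists_casselsTate_pairing (K := ℚ))
    (hGZK : rank_eq_analyticRank_of_analyticRank_le_one) (hmod : hasEntireLFunction_rat)
    (hp : 5 ≤ p) (hsurj : W.HasSurjectiveModNGaloisRep p) (hr : W.analyticRank = 1)
    {q : ℚ} (hq : shaAn W = (q : ℂ)) (hv : padicValRat p q = 0)
    {N : ℕ} [NeZero N] (D : ModularParametrizationData W N) (hc : ¬ (p : ℤ) ∣ D.maninConstant)
    (hper : ∃ u : ℚ, ‖(u : ℚ_[p])‖ = 1 ∧ W.realPeriodRat = u * plusPeriod D.f)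
    (ℓ : ℕ) [Fact ℓ.Prime] (hℓ : Kato.IsKolyvaginPrime W p 2 ℓ)
    (hcyc : Nat.card {P : ((WeierstrassCurve.integralModelInt W).map
        (Int.castRingHom (ZMod ℓ))).toAffine.Point // p • P = 0} ≤ p)
    (ψ : (ℓ' : ℕ) → (ZMod ℓ')ˣ →* Multiplicative (ZMod (p ^ 2)))
    (hψ : Function.Surjective (ψ ℓ)) (hδ : kuriharaNumber D.f (p ^ 2) ℓ ψ ≠ 0) : BSDp W p := by
  have hr1 : W.analyticRank ≤ 1 := by rw [hr]
  have hfin : W.ShaFinite := (hGZK W hr1).2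
  have h0 : padicValNat p W.shaOrder = 0 :=
    padicValNat_shaOrder_eq_zero_of_kim_rankOne_levelTwo_of_casselsTate W p hKim2 hCT hGZK hmod hp
      hsurj hr D hc hper ℓ hℓ hcyc ψ hψ hδ
  have hn : W.shaOrder ≠ 0 := (WeierstrassCurve.shaOrder_pos W hfin).ne'
  have hnd : ¬ p ∣ W.shaOrder := by
    intro hdvd
    have := (padicValNat_dvd_iff_le hn).1 (by simpa using hdvd : p ^ 1 ∣ W.shaOrder)
    omega
  refine bsdp_of_shaAn_unit_of_noPTorsion W p hGZK hr1 hq hv ?_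
  intro x hx
  by_contra hx0
  refine hnd (dvd_shaOrder_of_exists_torsion W p ⟨x, hx0, ?_⟩)
  rw [← natCast_zsmul]
  exact hx

/-! ### Class X4 (additive `p`), rank `1` -/

/-- **X4 ∧ `r = 1`, `p ≥ 5`, `ρ̄` onto, `#Ш_an` a `p`-unit, datum `D` with `p ∤ c_D` and period
transfer, ONE `δ̃_ℓ ≢ 0 (mod p²)` at `ℓ ∈ 𝒫_2` with the cyclicity flag: `BSD(E,p)`** — the census
shape over the cell's `ClassX4 W p` (RECLASSIFY item 31: the 2 rank-`1` X4 pairs with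
`ord_p ∏c_ℓ = 1` below `2·10⁴`, 14850cc1@5 and 18326j1@7; the period transfer and Manin datum of the
optimal curve are the additive-p3 seat's `X4.periodTransfer_of_optimal` / ARS Thm. 2.6). Per pair.
[cite: Kim2022StructureSelmer, Thm. 1.9 (6) (PDF p. 8)] [cite: SilvermanAEC2009, Thm. X.4.14]
[cite: Miller2011LMS, Def. 1.1] -/
theorem X4RankOne.bsdp_of_casselsTate_of_kuriharaNumber_levelTwo
    (hKim2 : Kim2022_rankOne_padicValNat_sha_le_one_of_kuriharaNumber_levelTwo_ne_zero_of_maninConstant)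
    (hCT : exists_casselsTate_pairing (K := ℚ))
    (hGZK : rank_eq_analyticRank_of_analyticRank_le_one) (hmod : hasEntireLFunction_rat)
    (hp : 5 ≤ p) (hX : ClassX4 W p) (hsurj : Surj W p) (hr : W.analyticRank = 1)
    {q : ℚ} (hq : shaAn W = (q : ℂ)) (hv : padicValRat p q = 0)
    {N : ℕ} [NeZero N] (D : ModularParametrizationData W N) (hc : ¬ (p : ℤ) ∣ D.maninConstant)
    (hper : ∃ u : ℚ, ‖(u : ℚ_[p])‖ = 1 ∧ W.realPeriodRat = u * plusPeriod D.f)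
    (ℓ : ℕ) [Fact ℓ.Prime] (hℓ : Kato.IsKolyvaginPrime W p 2 ℓ)
    (hcyc : Nat.card {P : ((WeierstrassCurve.integralModelInt W).map
        (Int.castRingHom (ZMod ℓ))).toAffine.Point // p • P = 0} ≤ p)
    (ψ : (ℓ' : ℕ) → (ZMod ℓ')ˣ →* Multiplicative (ZMod (p ^ 2)))
    (hψ : Function.Surjective (ψ ℓ)) (hδ : kuriharaNumber D.f (p ^ 2) ℓ ψ ≠ 0) : BSDp W p := by
  have _hirr : Irr W p := hX.2.2  -- recorded: the class predicate is X4; the step is class-agnostic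
  exact bsdp_of_kim_rankOne_levelTwo_of_casselsTate W p hKim2 hCT hGZK hmod hp hsurj hr hq hv D hc
    hper ℓ hℓ hcyc ψ hψ hδ

/-! ### Class X11b (multiplicative `p`, rank `1`) -/

/-- **X11b ∧ `p ≥ 5`, `ρ̄` onto, `#Ш_an` a `p`-unit, ONE `δ̃_ℓ ≢ 0 (mod p²)` at `ℓ ∈ 𝒫_2`:
`BSD(E,p)`** — over the v5 `ClassX11b W p` (`r_an = 1 ∧ p ≠ 2 ∧ Mult ∧ Irr`). The period transfer at
`p ∥ N` is the x11a seat's published fact `hϖ` (`realPeriodRat_eq_unit_mul_plusPeriod_of_multiplicative`,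
Mazur 1978 / GV 2000 Rem. 3.4) applied to `D.f`; the Manin hypothesis `p ∤ c_D` is kept as a binder
(vacuous in Kim's statement at `p ∥ N`, §1.3.5; per curve from ARS Thm. 2.6). Census `N < 2·10⁴`:
the 3 semistable X11b pairs with `ord_p ∏c_ℓ = 1` — 14835f1@5 (`δ̃_{1801} ≡ 5 (mod 25)`, engine B),
16390q1@5, 19090e1@5. Per pair; NOT a class theorem. [cite: Kim2022StructureSelmer, Thm. 1.9 (6) (PDF p. 8), §1.3.5]
[cite: SilvermanAEC2009, Thm. X.4.14] [cite: Miller2011LMS, Def. 1.1] -/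
theorem X11b.bsdp_of_casselsTate_of_kuriharaNumber_levelTwo
    (hKim2 : Kim2022_rankOne_padicValNat_sha_le_one_of_kuriharaNumber_levelTwo_ne_zero_of_maninConstant)
    (hϖ : realPeriodRat_eq_unit_mul_plusPeriod_of_multiplicative)
    (hCT : exists_casselsTate_pairing (K := ℚ))
    (hGZK : rank_eq_analyticRank_of_analyticRank_le_one) (hmod : hasEntireLFunction_rat)
    (hp : 5 ≤ p) (hX : ClassX11b W p) (hsurj : Surj W p)
    {q : ℚ} (hq : shaAn W = (q : ℂ)) (hv : padicValRat p q = 0)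
    {N : ℕ} [NeZero N] (D : ModularParametrizationData W N) (hc : ¬ (p : ℤ) ∣ D.maninConstant)
    (ℓ : ℕ) [Fact ℓ.Prime] (hℓ : Kato.IsKolyvaginPrime W p 2 ℓ)
    (hcyc : Nat.card {P : ((WeierstrassCurve.integralModelInt W).map
        (Int.castRingHom (ZMod ℓ))).toAffine.Point // p • P = 0} ≤ p)
    (ψ : (ℓ' : ℕ) → (ZMod ℓ')ˣ →* Multiplicative (ZMod (p ^ 2)))
    (hψ : Function.Surjective (ψ ℓ)) (hδ : kuriharaNumber D.f (p ^ 2) ℓ ψ ≠ 0) : BSDp W p :=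
  bsdp_of_kim_rankOne_levelTwo_of_casselsTate W p hKim2 hCT hGZK hmod hp hsurj hX.1 hq hv D hc
    (hϖ W p hp hX.2.2.1 hX.2.2.2 D.f D.isNewformOf) ℓ hℓ hcyc ψ hψ hδ

end Summit.BirchSwinnertonDyer.Rank1Residual

end
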